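import Summits.ValiantsHypothesis.ValiantsHypothesis.Theses.RealTau

/-!
# Crux `RealTau.RealVnTransfer` (stmt-ValiantsHypothesis-18102), line `realified-depth-four` —
# registered stub `stub_realEngine`

**Tavenas' Prop. 3.21 WITH CONSTANTS, over `ℝ`, for arbitrary families** (thesis 2014, proof of
Prop. 3.21, p. 47, with the circuit complexity `L_ℝ` in place of `τ`; Thm. 2.16 = the tree's
`DepthReduction.SLP.exists_sum_prod`): if `h_n ∈ ℝ[x_0, …, x_{d(n)-1}, z_0, …, z_{r(n)-1}]` is
multilinear, `r(n) ≤ d(n) ≤ (n+2)^{e₁}`, `L_ℝ(h_n) ≤ (n+2)^{e₂}`, and `f_n = h_n(v_n)` for a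
substitution `v_n` of TERMS `c X^e`, then `f_n = ∑_{i<k} ∏_{j<m} g_{ij}` in `ℝ[X]` with
`k, t ≤ (n+2)^{C(⌊√d(n)⌋+1)}`, `m ≤ C(⌊√d(n)⌋+1)` and every `g_{ij}` `t`-sparse, where
`C = prop321Const (e₁ + e₂ + 6)`.

The proof is the tree's proof of the constant-free twin
`Literature.Computability.AlgebraicComplexity.exists_sps_of_isProjection_perPoly`
(`RealTauConjectureViaVn.lean`), verbatim over `ℝ`: its single use of the hypothesis
`τ(PER) = n^{O(1)}` (the step `hsle : L(h_n) ≤ (n+2)^{e₂}`) is replaced by the hypothesis on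
`complexity h_n`, and the `ℚ`-valued substitution `kpSubst` by an arbitrary term substitution
(`card_support_aeval_le_of_isTerm`).  Every other ingredient is coefficient-generic:
`ArithCircuit.exists_computes_size_eq_complexity`, `DepthReduction.exists_slp`,
`DepthReduction.SLP.exists_sum_prod`, `DepthReduction.card_le_of_degree_le`, and the arithmetic
`prop321_exponent/kBound/mBound/tBound`.

Unconditional (axioms `propext`, `Classical.choice`, `Quot.sound`). References: S. Tavenas,
*Bornes inférieures et supérieures dans les circuits arithmétiques*, PhD thesis, ENS Lyon 2014,
Prop. 3.21 and Thm. 2.16; S. Tavenas, Inform. Comput. 240 (2015), Thm. 1.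
-/

noncomputable section

-- single-conjunct layout: Sub = Summit, duplicated namespace component intended
set_option linter.dupNamespace false

namespace Summit.ValiantsHypothesis.ValiantsHypothesis.Theorems.RealTauRealVnTransfer

open MvPolynomial Literature.Computability.AlgebraicComplexity

/-- **ENGINE — Tavenas' Prop. 3.21 with constants, over `ℝ`, for arbitrary families** (thesis
2014, proof of Prop. 3.21 p. 47 with `L_ℝ` in place of `τ`; Thm. 2.16 = the tree's
`DepthReduction.SLP.exists_sum_prod`): if `h_n ∈ ℝ[x_0..x_{d(n)-1}, z_0..z_{r(n)-1}]` is multilinear,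
`r(n) ≤ d(n) ≤ (n+2)^{e₁}`, `L_ℝ(h_n) ≤ (n+2)^{e₂}`, and `f_n = h_n(v_n)` for a substitution `v_n`
of TERMS `c X^e`, then `f_n = ∑_{i<k} ∏_{j<m} g_{ij}` in `ℝ[X]` with
`k, t ≤ (n+2)^{C(⌊√d(n)⌋+1)}`, `m ≤ C(⌊√d(n)⌋+1)`, every `g_{ij}` `t`-sparse.  Port of
`exists_sps_of_isProjection_perPoly` (its step `hsle` is the hypothesis; `isTerm_kpSubst` is `hv`).
Registered stub `stub_realEngine` of line `realified-depth-four`.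
[cite: Tavenas2014, Prop. 3.21 and Thm. 2.16] -/
theorem stub_realEngine :
    ∀ (f : ℕ → Polynomial ℝ) (d r : ℕ → ℕ) (e₁ e₂ : ℕ),
      (∀ n, d n ≤ (n + 2) ^ e₁) → (∀ n, r n ≤ d n) →
      ∀ v : ∀ n, Fin (d n) ⊕ Fin (r n) → Polynomial ℝ, (∀ n x, IsTerm (v n x)) →
      (∀ n, ∃ h : MvPolynomial (Fin (d n) ⊕ Fin (r n)) ℝ,
        complexity h ≤ (n + 2) ^ e₂ ∧ (∀ m ∈ h.support, ∀ x, m x ≤ 1) ∧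
          MvPolynomial.aeval (v n) h = f n) →
      ∃ C : ℕ, ∀ n, ∃ (k m t : ℕ) (g : Fin k → Fin m → Polynomial ℝ),
        k ≤ (n + 2) ^ (C * (Nat.sqrt (d n) + 1)) ∧
        m ≤ C * (Nat.sqrt (d n) + 1) ∧
        t ≤ (n + 2) ^ (C * (Nat.sqrt (d n) + 1)) ∧
        (∀ i j, (g i j).support.card ≤ t) ∧
        (∑ i, ∏ j, g i j) = f n := by
  classical
  intro f d r e₁ e₂ he₁ hrd v hv H
  refine ⟨prop321Const (e₁ + e₂ + 6), fun n => ?_⟩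
  obtain ⟨h, hcx, hml, hsub⟩ := H n
  have hB2 : 2 ≤ n + 2 := by omega
  have hD1 : 1 ≤ Nat.sqrt (d n) + 1 := Nat.succ_pos _
  have hu1 : 1 ≤ Nat.sqrt (d n + r n) + 1 := Nat.succ_pos _
  have hδd : d n + r n ≤ 2 * d n := by have := hrd n; omega
  have huD : Nat.sqrt (d n + r n) + 1 ≤ 2 * (Nat.sqrt (d n) + 1) := sqrt_add_one_le hδd
  have hRle : 8 * (d n + r n) / (Nat.sqrt (d n + r n) + 1 + 1) ≤ 16 * (Nat.sqrt (d n) + 1) :=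
    (rounds_le _).trans (by omega)
  -- size of a minimal circuit for `h` (an opaque name `s`, so that no tactic unfolds `complexity`)
  obtain ⟨s, hs⟩ : ∃ s : ℕ, complexity h = s := ⟨_, rfl⟩
  have hsle : s ≤ (n + 2) ^ e₂ := by rw [← hs]; exact hcx
  -- the exponent
  obtain ⟨hδ1, hsE, hu1', hδu⟩ := prop321_exponent hB2 (he₁ n) (hrd n) hsle
  -- the sparsity bound of a polynomial of degree `≤ u` in `δ` variables under the term substitution
  have hsparse : ∀ p : MvPolynomial (Fin (d n) ⊕ Fin (r n)) ℝ,
      p.totalDegree ≤ Nat.sqrt (d n + r n) + 1 →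
      (MvPolynomial.aeval (v n) p).support.card ≤
        (n + 2) ^ (prop321Const (e₁ + e₂ + 6) * (Nat.sqrt (d n) + 1)) := by
    intro p hp
    calc (MvPolynomial.aeval (v n) p).support.card ≤ p.support.card :=
          card_support_aeval_le_of_isTerm (hv n) p
      _ ≤ (Nat.sqrt (d n + r n) + 1 + 1) *
            (Fintype.card (Fin (d n) ⊕ Fin (r n)) + (Nat.sqrt (d n + r n) + 1)) ^
              (Nat.sqrt (d n + r n) + 1) :=
          DepthReduction.card_le_of_degree_le _ hu1 fun m hm => (le_totalDegree hm).trans hp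
      _ = (Nat.sqrt (d n + r n) + 1 + 1) *
            (d n + r n + (Nat.sqrt (d n + r n) + 1)) ^ (Nat.sqrt (d n + r n) + 1) := by
          rw [Fintype.card_sum, Fintype.card_fin, Fintype.card_fin]
      _ ≤ (n + 2) ^ (prop321Const (e₁ + e₂ + 6) * (Nat.sqrt (d n) + 1)) :=
          prop321_tBound hB2 hD1 hu1' hδu huD
  have hfmap : f n = MvPolynomial.aeval (v n) h := hsub.symm
  -- a minimal circuit for `h` and its straight-line program
  obtain ⟨P, hP1, hP2, hP3⟩ := ArithCircuit.exists_computes_size_eq_complexity h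
  obtain ⟨S, hSlen, hcases⟩ := DepthReduction.exists_slp P hP1
  rw [show P.eval = h from hP2] at hcases
  rw [hs] at hP3
  rcases hcases with ⟨i, hi, hval⟩ | htriv
  · -- main case: `h` is a value of the straight-line program
    have hdegh : (S.val i).totalDegree ≤ d n + r n := by
      rw [← hval]
      have := totalDegree_le_card_of_multilinear hml
      rwa [Fintype.card_sum, Fintype.card_fin, Fintype.card_fin] at this
    obtain ⟨L, hLsum, hLlen, hLT⟩ :=
      S.exists_sum_prod (d n + r n) (t := Nat.sqrt (d n + r n) + 1) hu1 hi hdegh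
    rw [hSlen, hP3] at hLlen
    refine ⟨L.length, 1 + 4 * (8 * (d n + r n) / (Nat.sqrt (d n + r n) + 1 + 1)),
      (n + 2) ^ (prop321Const (e₁ + e₂ + 6) * (Nat.sqrt (d n) + 1)),
      fun i j => MvPolynomial.aeval (v n) ((L[i.val]).getD j.val 1),
      hLlen.trans (prop321_kBound hB2 hD1 hδ1 hsE hRle), prop321_mBound hD1 hRle, le_rfl, ?_, ?_⟩
    · -- sparsity of the factors
      intro i j
      apply hsparse
      rcases DepthReduction.getD_one_mem_or (L[i.val]) j.val with hmem | hone
      · exact (hLT _ (List.getElem_mem _)).2 _ hmem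
      · rw [hone, totalDegree_one]; exact Nat.zero_le _
    · -- the identity `∑ ∏ g i j = f_n`
      rw [hfmap, hval, ← hLsum]
      have hprod : ∀ i : Fin L.length,
          ∏ j : Fin (1 + 4 * (8 * (d n + r n) / (Nat.sqrt (d n + r n) + 1 + 1))),
              MvPolynomial.aeval (v n) ((L[i.val]).getD j.val 1) =
            MvPolynomial.aeval (v n) (L[i.val]).prod := fun i => by
        rw [← map_prod, DepthReduction.prod_getD_one _ _ (hLT _ (List.getElem_mem _)).1]
      simp only [hprod]
      rw [map_list_sum, List.map_map]
      exact Fin.sum_univ_fun_getElem L (fun l => MvPolynomial.aeval (v n) l.prod)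
  · -- degenerate case: `h` is a variable or a constant, a single term
    have hterm : IsTerm (MvPolynomial.aeval (v n) h) := by
      rcases htriv with ⟨j, hj⟩ | ⟨c, hc⟩
      · rw [hj, MvPolynomial.aeval_X]; exact hv n j
      · rw [hc, MvPolynomial.aeval_C, Polynomial.algebraMap_eq]; exact isTerm_C c
    have h1 : 1 ≤ (n + 2) ^ (prop321Const (e₁ + e₂ + 6) * (Nat.sqrt (d n) + 1)) :=
      Nat.one_le_pow _ _ (by omega)
    refine ⟨1, 1, 1, fun _ _ => MvPolynomial.aeval (v n) h, h1,
      one_le_prop321Const_mul hD1, h1, fun _ _ => hterm.card_support_le, ?_⟩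
    rw [hfmap]; simp

end Summit.ValiantsHypothesis.ValiantsHypothesis.Theorems.RealTauRealVnTransfer

end
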